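import Mathlib
import Summits.Ventures.PercRepro.PuncturedLYMMixP1Q1Weight
import Summits.Ventures.PercRepro.PuncturedLYMMixP1Q1Rows
import Summits.Ventures.PercRepro.PuncturedLYMMixP1Q1Cols

/-!
# PercRepro — (SP) FOR `1` PAIRWISE DISJOINT PAIRS AND `1` PAIRWISE DISJOINT QUADRUPLES AT LEVEL `4` ON EVERY GROUND SET (THEOREM)
(p10, gen 41)

THE THEOREM `puncturedNMP_mix_P1_Q1`: for every finite type `α` and every family `C : Fin 2 → Finset α` of pairwise
disjoint members with `#(C i) = sz i` (`1` pairs, then `1` quadruples), the punctured normalised matching property (SP) holds at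
level `4` for the rows avoiding all members — no hypothesis on the number of points. For `n ≤ 4` there is no `5`-set; for `n ≥ 5`
the flow is the class-symmetric potential flow of the instance (PuncturedLYMMixP1Q1Table1 …; univariate in `n`) lifted by `W`
(…Weight): the row identities (…Rows) and the column identities (…Cols) are the type equations, the sums over the members are
grouped by (size, value) (`sum_eq_cnt`), the lift of PuncturedLYMTypeLift turns the table into a flow with row sums `1/#P` and
column sums `1/#Y`, and gen 36's bridge gives (SP).
-/

namespace PercRepro.PuncturedLYM.Split.TypeLift.MixP1Q1

open Finset

section Main

variable {α : Type} [DecidableEq α] [Fintype α]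

/-- Two of the members' up-levels are disjoint: a `4`-set contains at most one member (pairwise sums of sizes `≥ 6`). -/
theorem disjoint_upLevel_mem (C : Fin 2 → Finset α) (hcard : ∀ i, (C i).card = sz i)
    (hdisj : ∀ i l, i ≠ l → Disjoint (C i) (C l)) (i l : Fin 2) (hil : i ≠ l) :
    Disjoint (upLevel 4 (C i)) (upLevel 4 (C l)) := by
  rw [disjoint_left]
  intro X h1 h2
  rw [mem_upLevel] at h1 h2
  have := card_le_card (union_subset h1.2 h2.2)
  rw [card_union_of_disjoint (hdisj i l hil), hcard, hcard, h1.1] at this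
  by_cases hi : (i : ℕ) < 1 <;> by_cases hl : (l : ℕ) < 1
  · exact hil (Fin.ext (by omega))
  · have := sz_of_lt hi; have := sz_of_ge hl; omega
  · have := sz_of_ge hi; have := sz_of_lt hl; omega
  · have := sz_of_ge hi; have := sz_of_ge hl; omega

/-- The members occupy `6` of the `n` points. -/
theorem mem_mul_le_card (C : Fin 2 → Finset α) (hcard : ∀ i, (C i).card = sz i)
    (hdisj : ∀ i l, i ≠ l → Disjoint (C i) (C l)) : 6 ≤ Fintype.card α := by
  have h := card_le_univ ((univ : Finset (Fin 2)).biUnion C)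
  rw [card_biUnion (fun i _ l _ hil => hdisj i l hil)] at h
  simp only [hcard] at h
  rw [sum_sz] at h
  exact h

/-- `#P = C(n, 4) − 1 C(n − 2, 2) − 1 C(n − 4, 0) = Pc n` for `n = m' + 5`. -/
theorem card_punctured_mix (m' : ℕ) (hn : Fintype.card α = m' + 5) (C : Fin 2 → Finset α)
    (hcard : ∀ i, (C i).card = sz i) (hdisj : ∀ i l, i ≠ l → Disjoint (C i) (C l)) :
    (((punctured 4 ((univ : Finset (Fin 2)).biUnion (fun i => upLevel 4 (C i)))).card : ℕ) : ℚ) =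
      Pc ((m' : ℚ) + 5) := by
  unfold punctured
  have hsub : (univ : Finset (Fin 2)).biUnion (fun i => upLevel 4 (C i)) ⊆ (univ : Finset α).powersetCard 4 := by
    intro X hX
    obtain ⟨i, _, hXi⟩ := mem_biUnion.1 hX
    rw [mem_powersetCard]
    exact ⟨subset_univ X, (mem_upLevel.1 hXi).1⟩
  have hu : ∀ i, (upLevel 4 (C i)).card = if (i : ℕ) < 1 then (m' + 3).choose 2 else (m' + 1).choose 0 := by
    intro i
    rw [card_upLevel (by have := hcard i; have := sz_cases i; omega), hcard, hn]
    unfold sz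
    split_ifs with hi
    · rw [show m' + 5 - 2 = m' + 3 by omega, show (4 : ℕ) - 2 = 2 by norm_num]
    · rw [show m' + 5 - 4 = m' + 1 by omega, show (4 : ℕ) - 4 = 0 by norm_num]
  have hD : ((univ : Finset (Fin 2)).biUnion (fun i => upLevel 4 (C i))).card =
      1 * (m' + 3).choose 2 + 1 * (m' + 1).choose 0 := by
    rw [card_biUnion (fun i _ l _ hil => disjoint_upLevel_mem C hcard hdisj i l hil)]
    simp only [hu]
    rw [sum_ite, sum_const, sum_const, smul_eq_mul, smul_eq_mul]
    have h1 : (univ.filter (fun i : Fin 2 => (i : ℕ) < 1)).card = 1 := card_grp2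
    have h2 : (univ.filter (fun i : Fin 2 => ¬ (i : ℕ) < 1)).card = 1 := card_grp4
    rw [h1, h2]
  rw [card_sdiff_of_subset hsub, card_powersetCard, card_univ, hn, hD]
  have hle : 1 * (m' + 3).choose 2 + 1 * (m' + 1).choose 0 ≤ (m' + 5).choose 4 := by
    have := card_le_card hsub
    rw [card_powersetCard, card_univ, hn, hD] at this
    exact this
  rw [Nat.cast_sub hle, choose_l_cast, Nat.cast_add, Nat.cast_mul, Nat.cast_mul, choose_mA_cast, choose_mB_cast]
  push_cast
  unfold Pc
  ring

omit [DecidableEq α] in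
/-- `#Y = C(n, 5) = Yc n` for `n = m' + 5`. -/
theorem card_levelAbove_mix (m' : ℕ) (hn : Fintype.card α = m' + 5) :
    (((levelAbove α 4).card : ℕ) : ℚ) = Yc ((m' : ℚ) + 5) := by
  unfold levelAbove
  rw [card_powersetCard, card_univ, hn, choose_l1_cast]
  unfold Yc
  ring

/-! ### The theorem for `n ≥ 5` -/

/-- **THEOREM. (SP) for `1` pairwise disjoint pairs and `1` pairwise disjoint quadruples at level `4` on a ground set with
`n ≥ 5` points**, by the univariate type certificate. -/
theorem puncturedNMP_mix_of_le (m' : ℕ) (hn : Fintype.card α = m' + 5) (C : Fin 2 → Finset α)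
    (hcard : ∀ i, (C i).card = sz i) (hdisj : ∀ i l, i ≠ l → Disjoint (C i) (C l)) :
    PuncturedNMP 4 ((univ : Finset (Fin 2)).biUnion (fun i => upLevel 4 (C i))) := by
  apply puncturedNMP_of_hasFlow
  rw [card_punctured_mix m' hn C hcard hdisj, card_levelAbove_mix m' hn]
  set n : ℚ := (m' : ℚ) + 5 with hn_def
  have hn5 : (5 : ℚ) ≤ n := by rw [hn_def]; linarith [(Nat.cast_nonneg m' : (0 : ℚ) ≤ m')]
  have hn0 : (6 : ℚ) ≤ n := by
    have := mem_mul_le_card C hcard hdisj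
    rw [hn] at this
    rw [hn_def]
    exact_mod_cast this
  have hd := (den_pos n (by linarith)).ne'
  have hPc := (Pc_pos n (by linarith)).ne'
  have hY := (Yc_pos n hn5).ne'
  have hbig : ∀ i l, i ≠ l → 4 + 2 ≤ (C i).card + (C l).card := by
    intro i l hil
    rw [hcard, hcard]
    by_cases hi : (i : ℕ) < 1 <;> by_cases hl : (l : ℕ) < 1
    · exact absurd (Fin.ext (by omega)) hil
    · have := sz_of_lt hi; have := sz_of_ge hl; omega
    · have := sz_of_ge hi; have := sz_of_lt hl; omega
    · have := sz_of_ge hi; have := sz_of_ge hl; omega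
  have hfree : (freeSet C).card = m' + 5 - 6 := by
    rw [card_freeSet hdisj, hn]
    simp only [hcard]
    rw [sum_sz]
  have hfreeq : ((freeSet C).card : ℚ) = n - 6 := by
    rw [hfree, Nat.cast_sub (by have := mem_mul_le_card C hcard hdisj; rw [hn] at this; exact this), hn_def]
    push_cast
    ring
  refine hasFlow_of_typeWeights C (fun X hX => card_eq_of_mem_punctured_family hX) _ _ (W n)
    (fun a c d => W_nonneg n hn5 a c d) ?_ ?_
  · -- the rows
    intro X hX
    have hX' := mem_punctured_family.1 hX
    have ha : ∀ i, typ C X i < sz i := by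
      intro i
      have := typ_lt_card_of_not_subset C (hX'.2 i)
      rw [hcard] at this
      exact this
    have hs := sum_typ_add_fc hdisj X
    rw [hX'.1, sum_coords _ ha] at hs
    have hcA := cnt2_add _ ha
    have hcB := cnt4_add _ ha
    have hfc : fc C X ≤ (freeSet C).card := fc_le_card C X
    have hfq : (4 : ℚ) - cnt2 1 (typ C X) - cnt4 1 (typ C X) - 2 * cnt4 2 (typ C X) - 3 * cnt4 3 (typ C X) ≤ n - 6 := by
      have h1 : ((4 - cnt2 1 (typ C X) - cnt4 1 (typ C X) - 2 * cnt4 2 (typ C X) - 3 * cnt4 3 (typ C X) : ℕ) : ℚ) = (4 : ℚ) - cnt2 1 (typ C X) - cnt4 1 (typ C X) - 2 * cnt4 2 (typ C X) - 3 * cnt4 3 (typ C X) := by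
        rw [Nat.cast_sub (by omega), Nat.cast_sub (by omega), Nat.cast_sub (by omega), Nat.cast_sub (by omega)]
        push_cast
        ring
      rw [← h1, ← hfreeq]
      have : 4 - cnt2 1 (typ C X) - cnt4 1 (typ C X) - 2 * cnt4 2 (typ C X) - 3 * cnt4 3 (typ C X) ≤ (freeSet C).card := by omega
      exact_mod_cast this
    rw [rowSum_eq]
    have e : ∀ i, (((C i \ X).card : ℕ) : ℚ) * W n (typ C X) (fc C X) (some i) =
        (fun s v => (((s - v : ℕ)) : ℚ) * (wdir n (cnt2 1 (typ C X)) (cnt4 1 (typ C X)) (cnt4 2 (typ C X)) (cnt4 3 (typ C X)) (code s v) / Yc n)) (sz i) (typ C X i) := by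
      intro i
      rw [W_some, card_sdiff_eq_sub_typ, hcard]
    rw [sum_congr rfl (fun i _ => e i), sum_eq_cnt (typ C X) ha (fun s v => (((s - v : ℕ)) : ℚ) * (wdir n (cnt2 1 (typ C X)) (cnt4 1 (typ C X)) (cnt4 2 (typ C X)) (cnt4 3 (typ C X)) (code s v) / Yc n)),
      card_freeSet_sdiff, Nat.cast_sub hfc, hfreeq, W_none]
    simp only [code_fst, code_snd, Nat.reduceSub, Nat.reduceAdd, Nat.cast_ofNat, Nat.cast_one]
    have hcA0 : (cnt2 0 (typ C X) : ℚ) = 1 - ((cnt2 1 (typ C X) : ℚ)) := by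
      have : cnt2 0 (typ C X) = 1 - (cnt2 1 (typ C X)) := by omega
      rw [this, Nat.cast_sub (by omega)]
      push_cast
      ring
    have hcB0 : (cnt4 0 (typ C X) : ℚ) = 1 - ((cnt4 1 (typ C X) : ℚ) + cnt4 2 (typ C X) + cnt4 3 (typ C X)) := by
      have : cnt4 0 (typ C X) = 1 - (cnt4 1 (typ C X) + cnt4 2 (typ C X) + cnt4 3 (typ C X)) := by omega
      rw [this, Nat.cast_sub (by omega)]
      push_cast
      ring
    have hcq : (fc C X : ℚ) = (4 : ℚ) - cnt2 1 (typ C X) - cnt4 1 (typ C X) - 2 * cnt4 2 (typ C X) - 3 * cnt4 3 (typ C X) := by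
      have : fc C X = 4 - cnt2 1 (typ C X) - cnt4 1 (typ C X) - 2 * cnt4 2 (typ C X) - 3 * cnt4 3 (typ C X) := by omega
      rw [this, Nat.cast_sub (by omega), Nat.cast_sub (by omega), Nat.cast_sub (by omega), Nat.cast_sub (by omega)]
      push_cast
      ring
    rw [hcA0, hcB0, wdir_mA, wdir_mB,
      wdir_eq_raw n (cnt2 1 (typ C X)) (cnt4 1 (typ C X)) (cnt4 2 (typ C X)) (cnt4 3 (typ C X)) 0 (by norm_num) (by norm_num) hn0 hfq,
      wdir_eq_raw n (cnt2 1 (typ C X)) (cnt4 1 (typ C X)) (cnt4 2 (typ C X)) (cnt4 3 (typ C X)) 2 (by norm_num) (by norm_num) hn0 hfq,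
      wdir_eq_raw n (cnt2 1 (typ C X)) (cnt4 1 (typ C X)) (cnt4 2 (typ C X)) (cnt4 3 (typ C X)) 3 (by norm_num) (by norm_num) hn0 hfq,
      wdir_eq_raw n (cnt2 1 (typ C X)) (cnt4 1 (typ C X)) (cnt4 2 (typ C X)) (cnt4 3 (typ C X)) 4 (by norm_num) (by norm_num) hn0 hfq,
      wdir_eq_raw n (cnt2 1 (typ C X)) (cnt4 1 (typ C X)) (cnt4 2 (typ C X)) (cnt4 3 (typ C X)) 6 (by norm_num) (by norm_num) hn0 hfq,
      hcq]
    have key := row_check n hd hPc (cnt2 1 (typ C X)) (cnt4 1 (typ C X)) (cnt4 2 (typ C X)) (cnt4 3 (typ C X)) (by omega) (by omega) (by omega)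
    rw [show (1 : ℚ) / Pc n = (Yc n / Pc n) / Yc n by field_simp, ← key]
    ring
  · -- the columns
    intro Y hY
    have hYc : Y.card = 4 + 1 := (mem_cols.1 hY).2
    by_cases hmem : ∃ i₀, C i₀ ⊆ Y
    · obtain ⟨i₀, hi₀⟩ := hmem
      rw [colSum_eq_of_member (W n) hdisj hbig hYc hi₀, hcard, W_some]
      have hi : typ C Y i₀ = sz i₀ := by rw [typ_eq_card_of_subset C hi₀, hcard]
      rw [Function.update_self, hi]
      rcases sz_cases i₀ with h3 | h4
      · rw [h3]
        simp only [code_fst, Nat.reduceSub]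
        rw [wdir_mA]
        push_cast
        ring
      · rw [h4]
        simp only [code_snd, Nat.reduceSub, Nat.reduceAdd]
        rw [wdir_mB]
        push_cast
        ring
    · have hmem' : ∀ i, ¬ C i ⊆ Y := fun i h => hmem ⟨i, h⟩
      rw [colSum_eq_of_free (W n) hdisj hYc hmem']
      have hb : ∀ i, typ C Y i < sz i := by
        intro i
        have := typ_lt_card_of_not_subset C (hmem' i)
        rw [hcard] at this
        exact this
      have hs := sum_typ_add_fc hdisj Y
      rw [hYc, sum_coords _ hb] at hs
      have hcA := cnt2_add _ hb
      have hcB := cnt4_add _ hb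
      have hfc : fc C Y ≤ (freeSet C).card := fc_le_card C Y
      set d21 := cnt2 1 (typ C Y) with hd21
      set d41 := cnt4 1 (typ C Y) with hd41
      set d42 := cnt4 2 (typ C Y) with hd42
      set d43 := cnt4 3 (typ C Y) with hd43
      set c := fc C Y with hc
      have e : ∀ i, ((typ C Y i : ℕ) : ℚ) * W n (Function.update (typ C Y) i (typ C Y i - 1)) c (some i) =
          (fun s v => ((v : ℕ) : ℚ) * (if code s v = 1 then wdir n (d21 - 1) d41 d42 d43 0 / Yc n else if code s v = 3 then wdir n d21 (d41 - 1) d42 d43 2 / Yc n else if code s v = 4 then wdir n d21 (d41 + 1) (d42 - 1) d43 3 / Yc n else if code s v = 5 then wdir n d21 d41 (d42 + 1) (d43 - 1) 4 / Yc n else 0)) (sz i) (typ C Y i) := by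
        intro i
        rw [W_some, Function.update_self]
        have h21 := cnt2_update 1 (typ C Y) i (typ C Y i - 1)
        have h41 := cnt4_update 1 (typ C Y) i (typ C Y i - 1)
        have h42 := cnt4_update 2 (typ C Y) i (typ C Y i - 1)
        have h43 := cnt4_update 3 (typ C Y) i (typ C Y i - 1)
        rw [← hd21] at h21
        rw [← hd41] at h41
        rw [← hd42] at h42
        rw [← hd43] at h43
        have hi := hb i
        by_cases hsz : (i : ℕ) < 1
        · have hsA := sz_of_lt hsz
          rw [hsA] at hi ⊢
          simp only [hsz, true_and, not_true_eq_false, false_and, if_false, add_zero] at h21 h41 h42 h43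
          rcases Nat.lt_or_ge (typ C Y i) 1 with h0 | h0
          · have hu : typ C Y i = 0 := by omega
            rw [hu]
            simp
          · have hu : typ C Y i = 1 := by omega
            rw [hu] at h21 h41 h42 h43 ⊢
            norm_num at h21 h41 h42 h43
            simp only [Nat.reduceSub]
            have e1 : cnt2 1 (Function.update (typ C Y) i 0) = d21 - 1 := by omega
            have e2 : cnt4 1 (Function.update (typ C Y) i 0) = d41 := by omega
            have e3 : cnt4 2 (Function.update (typ C Y) i 0) = d42 := by omega
            have e4 : cnt4 3 (Function.update (typ C Y) i 0) = d43 := by omega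
            rw [e1, e2, e3, e4]
            simp [code_fst]
        · have hsB := sz_of_ge hsz
          rw [hsB] at hi ⊢
          simp only [hsz, true_and, not_false_eq_true, false_and, if_false, add_zero] at h21 h41 h42 h43
          rcases Nat.lt_or_ge (typ C Y i) 1 with h0 | h0
          · have hu : typ C Y i = 0 := by omega
            rw [hu]
            simp
          rcases Nat.lt_or_ge (typ C Y i) 2 with h1 | h1
          · have hu : typ C Y i = 1 := by omega
            rw [hu] at h21 h41 h42 h43 ⊢
            norm_num at h21 h41 h42 h43
            simp only [Nat.reduceSub]
            have e1 : cnt2 1 (Function.update (typ C Y) i 0) = d21 := by omega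
            have e2 : cnt4 1 (Function.update (typ C Y) i 0) = d41 - 1 := by omega
            have e3 : cnt4 2 (Function.update (typ C Y) i 0) = d42 := by omega
            have e4 : cnt4 3 (Function.update (typ C Y) i 0) = d43 := by omega
            rw [e1, e2, e3, e4]
            simp [code_snd]
          rcases Nat.lt_or_ge (typ C Y i) 3 with h2 | h2
          · have hu : typ C Y i = 2 := by omega
            rw [hu] at h21 h41 h42 h43 ⊢
            norm_num at h21 h41 h42 h43
            simp only [Nat.reduceSub]
            have e1 : cnt2 1 (Function.update (typ C Y) i 1) = d21 := by omega
            have e2 : cnt4 1 (Function.update (typ C Y) i 1) = d41 + 1 := by omega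
            have e3 : cnt4 2 (Function.update (typ C Y) i 1) = d42 - 1 := by omega
            have e4 : cnt4 3 (Function.update (typ C Y) i 1) = d43 := by omega
            rw [e1, e2, e3, e4]
            simp [code_snd]
          · have hu : typ C Y i = 3 := by omega
            rw [hu] at h21 h41 h42 h43 ⊢
            norm_num at h21 h41 h42 h43
            simp only [Nat.reduceSub]
            have e1 : cnt2 1 (Function.update (typ C Y) i 2) = d21 := by omega
            have e2 : cnt4 1 (Function.update (typ C Y) i 2) = d41 := by omega
            have e3 : cnt4 2 (Function.update (typ C Y) i 2) = d42 + 1 := by omega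
            have e4 : cnt4 3 (Function.update (typ C Y) i 2) = d43 - 1 := by omega
            rw [e1, e2, e3, e4]
            simp [code_snd]
      rw [sum_congr rfl (fun i _ => e i), sum_eq_cnt (typ C Y) hb (fun s v => ((v : ℕ) : ℚ) * (if code s v = 1 then wdir n (d21 - 1) d41 d42 d43 0 / Yc n else if code s v = 3 then wdir n d21 (d41 - 1) d42 d43 2 / Yc n else if code s v = 4 then wdir n d21 (d41 + 1) (d42 - 1) d43 3 / Yc n else if code s v = 5 then wdir n d21 d41 (d42 + 1) (d43 - 1) 4 / Yc n else 0)), W_none]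
      simp only [code_fst, code_snd, Nat.reduceAdd, Nat.cast_zero, mul_zero, Nat.cast_one, one_mul,
        Nat.cast_ofNat, if_true, if_false, Nat.reduceEqDiff]
      rw [← hd21, ← hd41, ← hd42, ← hd43]
      have hcq : (c : ℚ) = (5 : ℚ) - d21 - d41 - 2 * d42 - 3 * d43 := by
        have : c = 5 - d21 - d41 - 2 * d42 - 3 * d43 := by omega
        rw [this, Nat.cast_sub (by omega), Nat.cast_sub (by omega), Nat.cast_sub (by omega), Nat.cast_sub (by omega)]
        push_cast
        ring
      have hcle : (c : ℚ) ≤ n - 6 := by rw [← hfreeq]; exact_mod_cast hfc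
      have t_d21 : (d21 : ℚ) * (wdir n (d21 - 1) d41 d42 d43 0 / Yc n) = (d21 : ℚ) * (raw n (d21 - 1) d41 d42 d43 0 / Yc n) := by
        rcases Nat.eq_zero_or_pos d21 with h | h
        · rw [h]; simp
        · rw [wdir_eq_raw n (d21 - 1) d41 d42 d43 0 (by norm_num) (by norm_num) hn0]
          rw [Nat.cast_sub h]; push_cast; linarith
      have t_d41 : (d41 : ℚ) * (wdir n d21 (d41 - 1) d42 d43 2 / Yc n) = (d41 : ℚ) * (raw n d21 (d41 - 1) d42 d43 2 / Yc n) := by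
        rcases Nat.eq_zero_or_pos d41 with h | h
        · rw [h]; simp
        · rw [wdir_eq_raw n d21 (d41 - 1) d42 d43 2 (by norm_num) (by norm_num) hn0]
          rw [Nat.cast_sub h]; push_cast; linarith
      have t_d42 : (d42 : ℚ) * (2 * (wdir n d21 (d41 + 1) (d42 - 1) d43 3 / Yc n)) = (d42 : ℚ) * (2 * (raw n d21 (d41 + 1) (d42 - 1) d43 3 / Yc n)) := by
        rcases Nat.eq_zero_or_pos d42 with h | h
        · rw [h]; simp
        · rw [wdir_eq_raw n d21 (d41 + 1) (d42 - 1) d43 3 (by norm_num) (by norm_num) hn0]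
          rw [Nat.cast_sub h]; push_cast; linarith
      have t_d43 : (d43 : ℚ) * (3 * (wdir n d21 d41 (d42 + 1) (d43 - 1) 4 / Yc n)) = (d43 : ℚ) * (3 * (raw n d21 d41 (d42 + 1) (d43 - 1) 4 / Yc n)) := by
        rcases Nat.eq_zero_or_pos d43 with h | h
        · rw [h]; simp
        · rw [wdir_eq_raw n d21 d41 (d42 + 1) (d43 - 1) 4 (by norm_num) (by norm_num) hn0]
          rw [Nat.cast_sub h]; push_cast; linarith
      have tF : (c : ℚ) * (wdir n d21 d41 d42 d43 6 / Yc n) = (c : ℚ) * (raw n d21 d41 d42 d43 6 / Yc n) := by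
        rcases Nat.eq_zero_or_pos c with h | h
        · rw [h]; simp
        · rw [wdir_eq_raw n d21 d41 d42 d43 6 (by norm_num) (by norm_num) hn0]
          have : (1 : ℚ) ≤ c := by exact_mod_cast h
          linarith
      rw [t_d21, t_d41, t_d42, t_d43, tF, hcq]
      have key := col_check n hd d21 d41 d42 d43 (by omega) (by omega) (by omega)
      rw [show (1 : ℚ) / Yc n = (1 * (d21 : ℚ) * raw n (d21 - 1) d41 d42 d43 0 + 1 * (d41 : ℚ) * raw n d21 (d41 - 1) d42 d43 2 + 2 * (d42 : ℚ) * raw n d21 (d41 + 1) (d42 - 1) d43 3 + 3 * (d43 : ℚ) * raw n d21 d41 (d42 + 1) (d43 - 1) 4 + ((5 : ℚ) - d21 - d41 - 2 * d42 - 3 * d43) * raw n d21 d41 d42 d43 6) / Yc n by rw [key]]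
      ring

/-- **THEOREM. (SP) for `1` pairwise disjoint pairs and `1` pairwise disjoint quadruples at level `4` on EVERY finite ground
set** (`sz i = if i < 1 then 2 else 4`). -/
theorem puncturedNMP_mix_P1_Q1 (C : Fin 2 → Finset α) (hcard : ∀ i, (C i).card = sz i)
    (hdisj : ∀ i l, i ≠ l → Disjoint (C i) (C l)) :
    PuncturedNMP 4 ((univ : Finset (Fin 2)).biUnion (fun i => upLevel 4 (C i))) := by
  rcases Nat.lt_or_ge (Fintype.card α) 5 with h | h
  · exact puncturedNMP_of_card_le _ (by omega)
  · obtain ⟨m', hm⟩ : ∃ m', Fintype.card α = m' + 5 := ⟨Fintype.card α - 5, by omega⟩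
    exact puncturedNMP_mix_of_le m' hm C hcard hdisj

end Main

end PercRepro.PuncturedLYM.Split.TypeLift.MixP1Q1
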